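import Summits.CriticalPhenomena.PercolationContinuityZ3.Theorems.PercNearOneGluingNoHeavyLowerTailUpsetExchangeUnion
import HarnessLib

/-!
# `NoHeavyLowerTail` (stmt-CriticalPhenomena-4575) — the MERGED CORNER IS FREE: one mixed sub-block row already puts the
# witness below the fully glued block (2+k goodness kernel, finding F1 of prim-hp-2 gen 10)

Support file (`--supports stmt-CriticalPhenomena-4575`, hull-port prover `prim-hp-2`, gen 10).  No definitions, no named
facts, no sorries.  Memo: `run/shared/lean/prim/prim-hp-2/MEMO-gen10-two-relays-universal-goodness.md` §3 (F1).

Setting of the 2+k kernel at goodness strength (MEMO-gen6 §5, MEMO-gen8 §5): ranking graph `w` (= `K + y`, `y` the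
genuine child), the formal unit glues the pair `T = {p₁, p₂}` with probability `u`, and the relay rows say that the
witness `j` is, ON AVERAGE over the coin, below every relay — in particular below the port `p`:
`(1−u)·(μ_w(p↔b) − μ_w(j↔b)) + u·(μ_{w/T}(p↔b) − μ_{w/T}(j↔b)) ≥ 0`.
The merged corner of the GC functional compares `j` with the FULLY glued block `S = T ∪ {y}` in `w/S`.

* `KNGoodMergedCorner.glue_glue_of_subset` — gluing `T ⊆ S` and then `S` is gluing `S`.
* `KNGoodMergedCorner.mergedCorner_le` — **for every `u ∈ [0,1]`, every `T ⊆ S`, `p ∈ S` and EVERY vertex `j`: the mixed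
  row of `p` implies `μ_{w/S}(j ↔ b) ≤ μ_{w/S}(p ↔ b)`.**  Proof: a convex combination of two numbers is `≥ 0` only if one
  of them is, and either ranking (`j ≤ p` in `w`, or in `w/T`) is transported into `w/S` by the hub exchange with the
  anchor `p` inside the block (`UpsetExchange.hubExchange_union`, Kozma–Nitzan Lemma 5 / Lemma 3(i)).
So in the FF corner `T(u;j) = (1−u)·a_j + u·c_j` the merged term `c_j` is never negative for a feasible witness; only
the Theorem-4 functional `a_j` of the child can be (memo §3 (F1)–(F2)).
[cite: KozmaNitzan2024, Lemma 5 (p. 13), Lemma 3(i) (p. 6); VandenbergHaggstromKahn2005, Thm. 1.2]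
-/

noncomputable section

namespace Summit.CriticalPhenomena.PercolationContinuityZ3.Theorems

open MeasureTheory Set Literature.Probability.LatticeModels Literature.Probability.Percolation
open scoped Classical

namespace KNGoodMergedCorner

variable {n : ℕ}

/-- Gluing a sub-block `T ⊆ S` first and then `S` is the same weight function as gluing `S`. [folklore] -/
theorem glue_glue_of_subset (w : Sym2 (Fin n) → unitInterval) (S T : Finset (Fin n)) (hTS : T ⊆ S) :
    (fun e : Sym2 (Fin n) => if (∀ x ∈ e, x ∈ S) ∧ ¬ e.IsDiag then (1 : unitInterval) else
        (fun e' : Sym2 (Fin n) => if (∀ x ∈ e', x ∈ T) ∧ ¬ e'.IsDiag then (1 : unitInterval) else w e') e) =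
      (fun e : Sym2 (Fin n) => if (∀ x ∈ e, x ∈ S) ∧ ¬ e.IsDiag then 1 else w e) := by
  funext e
  by_cases hS : (∀ x ∈ e, x ∈ S) ∧ ¬ e.IsDiag
  · rw [if_pos hS, if_pos hS]
  · have hT : ¬ ((∀ x ∈ e, x ∈ T) ∧ ¬ e.IsDiag) := fun h => hS ⟨fun x hx => hTS (h.1 x hx), h.2⟩
    rw [if_neg hS, if_neg hS]
    show (if (∀ x ∈ e, x ∈ T) ∧ ¬ e.IsDiag then (1 : unitInterval) else w e) = w e
    rw [if_neg hT]

/-- **The merged corner is free.**  `T ⊆ S` finite vertex sets, `p ∈ S`, `u ∈ [0,1]`, `j, b` any vertices.  If the mixed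
row of `p` holds — `0 ≤ (1−u)(μ_w(p↔b) − μ_w(j↔b)) + u(μ_{w/T}(p↔b) − μ_{w/T}(j↔b))` — then in the fully glued graph
`μ_{w/S}(j ↔ b) ≤ μ_{w/S}(p ↔ b)`.  (2+k kernel: `T` = the ports of the formal unit, `S = T ∪ {y}`, `w = K + y`.)
[cite: KozmaNitzan2024, Lemma 5 (p. 13), Lemma 3(i) (p. 6); VandenbergHaggstromKahn2005, Thm. 1.2] -/
theorem mergedCorner_le (w : Sym2 (Fin n) → unitInterval) (S T : Finset (Fin n)) (hTS : T ⊆ S)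
    (p j b : Fin n) (hp : p ∈ S) (u : ℝ) (hu0 : 0 ≤ u) (hu1 : u ≤ 1)
    (hrow : 0 ≤ (1 - u) * ((prodBernoulli w).real (openConn p b) - (prodBernoulli w).real (openConn j b)) +
      u * ((prodBernoulli (fun e : Sym2 (Fin n) => if (∀ x ∈ e, x ∈ T) ∧ ¬ e.IsDiag then 1 else w e)).real
              (openConn p b) -
            (prodBernoulli (fun e : Sym2 (Fin n) => if (∀ x ∈ e, x ∈ T) ∧ ¬ e.IsDiag then 1 else w e)).real
              (openConn j b))) :
    (prodBernoulli (fun e : Sym2 (Fin n) => if (∀ x ∈ e, x ∈ S) ∧ ¬ e.IsDiag then 1 else w e)).real (openConn j b) ≤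
      (prodBernoulli (fun e : Sym2 (Fin n) => if (∀ x ∈ e, x ∈ S) ∧ ¬ e.IsDiag then 1 else w e)).real
        (openConn p b) := by
  set wT : Sym2 (Fin n) → unitInterval := fun e => if (∀ x ∈ e, x ∈ T) ∧ ¬ e.IsDiag then 1 else w e with hwT
  -- the hub exchange with anchor `p ∈ S` and the trivial union event `{ω | ∅ ⊆ ω}`
  have hC : ∀ C ∈ ({∅} : Finset (Finset (Sym2 (Fin n)))), ∀ e ∈ C, ¬ e.IsDiag ∧ ∃ x ∈ e, x ∈ S := by
    intro C hC e he
    rw [Finset.mem_singleton] at hC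
    subst hC
    exact absurd he (Finset.notMem_empty e)
  have hE : {ω : BondConfig (Fin n) | ∃ C ∈ ({∅} : Finset (Finset (Sym2 (Fin n)))), (↑C : Set (Sym2 (Fin n))) ⊆ ω} =
      univ := by
    ext ω
    simp
  have transfer : ∀ (v : Sym2 (Fin n) → unitInterval),
      (prodBernoulli v).real (openConn j b) ≤ (prodBernoulli v).real (openConn p b) →
      (prodBernoulli (fun e : Sym2 (Fin n) => if (∀ x ∈ e, x ∈ S) ∧ ¬ e.IsDiag then 1 else v e)).real (openConn j b) ≤
        (prodBernoulli (fun e : Sym2 (Fin n) => if (∀ x ∈ e, x ∈ S) ∧ ¬ e.IsDiag then 1 else v e)).real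
          (openConn p b) := by
    intro v hyp
    have h := UpsetExchange.hubExchange_union v S j b p hp {∅} hC hyp
    rwa [hE, inter_univ, inter_univ] at h
  by_cases h1 : (prodBernoulli w).real (openConn j b) ≤ (prodBernoulli w).real (openConn p b)
  · exact transfer w h1
  · -- then the glued ranking must hold
    have h1' : (prodBernoulli w).real (openConn p b) - (prodBernoulli w).real (openConn j b) < 0 := by linarith
    have h2 : (prodBernoulli wT).real (openConn j b) ≤ (prodBernoulli wT).real (openConn p b) := by
      by_contra h2
      have h2' : (prodBernoulli wT).real (openConn p b) - (prodBernoulli wT).real (openConn j b) < 0 := by linarith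
      rcases eq_or_lt_of_le hu0 with hu | hu
      · have hB : u * ((prodBernoulli wT).real (openConn p b) - (prodBernoulli wT).real (openConn j b)) = 0 := by
          rw [← hu, zero_mul]
        have hA : (1 - u) * ((prodBernoulli w).real (openConn p b) - (prodBernoulli w).real (openConn j b)) < 0 := by
          rw [← hu, sub_zero, one_mul]; exact h1'
        linarith
      · have hA : (1 - u) * ((prodBernoulli w).real (openConn p b) - (prodBernoulli w).real (openConn j b)) ≤ 0 :=
          mul_nonpos_of_nonneg_of_nonpos (by linarith) h1'.le
        have hB : u * ((prodBernoulli wT).real (openConn p b) - (prodBernoulli wT).real (openConn j b)) < 0 :=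
          mul_neg_of_pos_of_neg hu h2'
        linarith
    have h := transfer wT h2
    rw [hwT, glue_glue_of_subset w S T hTS] at h
    exact h

end KNGoodMergedCorner

end Summit.CriticalPhenomena.PercolationContinuityZ3.Theorems

end
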